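import Literature.AlgebraicGeometry.ShimuraVarieties.UnitaryBallH1RestrictionToSpecialCurvesHolds
import HarnessLib

/-!
# The IMAGE form «III-8 `MR92Prop6`» from the SOURCE form «III-8′ `MR92Prop6Source`» (★ proved): a compatible uniformised special
# curve lands in the special curve, so restriction to the image curve detects what pull-back to the source detects

Topic `AlgebraicGeometry/ShimuraVarieties`; namespace `Literature.AlgebraicGeometry.ShimuraVarieties` (sub-namespace
`UnitaryBallQuotientDatum`).  THEOREMS ONLY (no `def`, no named fact, no instance, no `sorry`).

Let `D : UnitaryBallQuotientDatum 2 X` present a compact arithmetic ball quotient `X(ℂ) ≅ Γ∖𝔹²` WITH its special subvarieties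
(★ `UnitaryBallQuotientDatum.lean`: for a totally positive definite `E`-subspace `W ⊆ V = E³` the Zariski-closed
`D.specialSubvariety W ⊆ X` whose complex points are `unif (subCone H^{τ₁} (τ₁ W))`, field `pt_mem_specialSubvariety_iff`), and let
`(Y, D₁, φ, M)` be a compatible uniformised special curve over `(D, W)` (★ `IsCompatibleSpecialSource`, [Liu2021] proof of Thm. 4.15
l. 2207: clauses `gram`, `orthogonal`, `group`, `unif_comp`).  Then:

* `map_mem_specialPoints_of_isCompatibleSpecialSource` — **`φ(ℂ)` maps `Y(ℂ)` INTO the special curve `C_W(ℂ) = D.specialPoints W`**: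
  a point `y = unif₁ v` (`v` negative for `H₁`) goes to `unif (M v)` (`unif_comp`), and `M v` lies in the sub-cone of `τ₁ W`
  (`M v` is negative by `gram`, ★ `IsCompatibleSpecialSource.mulVec_mem_negCone_iff`, and orthogonal to `τ₁ W` by `orthogonal`).
* `map_mapContinuous_eq_restrictToSpecial_comp` — hence the pull-back `Hⁱ(φ(ℂ))` FACTORS through the restriction to the image curve:
  `Hⁱ(φ(ℂ)) = D.restrictToSpecial W i ≫ Hⁱ(φ(ℂ)|^{C_W})` (functoriality of singular cohomology), and
  `map_mapContinuous_eq_zero_of_restrictToSpecial_eq_zero` — a class dying on the image curve dies on the source.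
* **`mr92Prop6_of_forall_exists_compatibleSpecialSource`** — if EVERY totally positive definite `E`-line `W` carries at least one
  compatible uniformised special curve, then the IMAGE form ★ `MR92Prop6 D` (row III-8 as first typed: every non-zero degree-one class
  restricts non-trivially to the special curve of some totally positive line) follows from the SOURCE form, which is now a THEOREM
  (★ `UnitaryBallUniformisationDatum.mr92Prop6Source`, [MurtyRamakrishnan1992] §5 Lemma A/B + Cor. C, [Liu2021] fn. 9).  The hypothesis
  is exactly «one compatible triple per line» (the algebraisation `Γ_W∖𝔻 → X` of the compact special curves), recorded as owed in the
  docstrings of ★ `UnitaryBallH1RestrictionToSpecialCurves.lean` §III-8′; it is supplied level-wise by the cell hodgecm-mathlib's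
  road (ii) R2-2 («special curve datum», in flight) — nothing about existence of curves is proved HERE.
* `mr92Prop6_of_exists_compatibleSpecialSource_of_line` — the same with the hypothesis asked only of the detecting line of each class
  (the form a level-restricted existence theorem meets).

## References
* [Liu2021] Y. Liu, arXiv:2102.11518 = Camb. J. Math. 9 (2021), proof of Thm. 4.15, l. 2207 and l. 2212 with footnote 9.
* [MurtyRamakrishnan1992] V. K. Murty, D. Ramakrishnan, *The Albanese of unitary Shimura varieties*, CRM Montréal (1992), §5 Prop. 6
  p. 460, Lemma B p. 462, Cor. C pp. 462–463 (lit1 shelf card).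
* [BergeronMillsonMoeglin2016Balls] N. Bergeron, J. Millson, C. Moeglin, Acta Math. 216 (2016), Part 2 §§3.1–3.3 (special cycles of
  ball quotients as images of sub-balls).
* [HatcherAT2002] A. Hatcher, *Algebraic Topology* (2002), §3.1 (functoriality of singular cohomology).
-/

noncomputable section

open CategoryTheory Matrix Set

namespace Literature.AlgebraicGeometry.ShimuraVarieties

open Literature.AlgebraicGeometry.Motives (SchemeOver ComplexPoints AlgPoints)
open Literature.AlgebraicGeometry.HodgeTheory
open Literature.AlgebraicTopology.SingularHomology

variable {X : SchemeOver ℂ}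

namespace UnitaryBallQuotientDatum

/-- **A compatible uniformised special curve lands in the special curve**: for `(Y, D₁, φ, M)` compatible over `(D, W)` (`W` totally
positive definite), `φ(ℂ)(y) ∈ C_W(ℂ)` for every `y ∈ Y(ℂ)` — `y = unif₁ v`, `φ(ℂ)(y) = unif (M v)` with `M v ∈ subCone H^{τ₁} (τ₁ W)`.
[cite: Liu2021, proof of Thm. 4.15, l. 2207] [cite: BergeronMillsonMoeglin2016Balls, Part 2 §§3.1–3.3] -/
theorem map_mem_specialPoints_of_isCompatibleSpecialSource (D : UnitaryBallQuotientDatum 2 X)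
    {W : Submodule D.E (Fin 3 → D.E)} (hW : IsTotallyPositive (conjRingHom D.E) D.H W)
    {Y : SchemeOver ℂ} {D₁ : UnitaryBallUniformisationDatum 1 Y} {φ : Y ⟶ X} {M : Matrix (Fin 3) (Fin 2) ℂ}
    (h : D.IsCompatibleSpecialSource W D₁ φ M) (y : ComplexPoints Y) :
    AlgPoints.map φ y ∈ D.specialPoints W := by
  obtain ⟨v, hv, rfl⟩ := D₁.surjOn_unif (mem_univ y)
  rw [mem_specialPoints_iff, D.pt_mem_specialSubvariety_iff W hW]
  refine ⟨M *ᵥ v, ⟨?_, ?_⟩, (h.unif_comp v hv).symm⟩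
  · exact (h.mulVec_mem_negCone_iff D.toUnitaryBallUniformisationDatum v).2 hv
  · rintro _ ⟨w, hw, rfl⟩
    exact h.orthogonal w hw v

/-- The co-restriction of `φ(ℂ)` to the special curve `C_W(ℂ)` composed with the inclusion is `φ(ℂ)`. [cite: HatcherAT2002, §3.1] -/
theorem subtypeVal_comp_codRestrict_mapContinuous (D : UnitaryBallQuotientDatum 2 X)
    {W : Submodule D.E (Fin 3 → D.E)} (hW : IsTotallyPositive (conjRingHom D.E) D.H W)
    {Y : SchemeOver ℂ} {D₁ : UnitaryBallUniformisationDatum 1 Y} {φ : Y ⟶ X} {M : Matrix (Fin 3) (Fin 2) ℂ}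
    (h : D.IsCompatibleSpecialSource W D₁ φ M) :
    (⟨Subtype.val, continuous_subtype_val⟩ : C(D.specialPoints W, ComplexPoints X)).comp
        ⟨fun y ↦ ⟨AlgPoints.map φ y, D.map_mem_specialPoints_of_isCompatibleSpecialSource hW h y⟩,
          (AlgPoints.continuous_map φ).subtype_mk _⟩ =
      AlgPoints.mapContinuous (L := ℂ) φ :=
  ContinuousMap.ext fun _ ↦ rfl

/-- **`Hⁱ(φ(ℂ))` factors through the restriction to the image curve**: `Hⁱ(φ(ℂ)) = restrictToSpecial W i ≫ Hⁱ(φ(ℂ)|^{C_W})`.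
[cite: HatcherAT2002, §3.1] [cite: Liu2021, proof of Thm. 4.15, l. 2212] -/
theorem map_mapContinuous_eq_restrictToSpecial_comp (D : UnitaryBallQuotientDatum 2 X)
    {W : Submodule D.E (Fin 3 → D.E)} (hW : IsTotallyPositive (conjRingHom D.E) D.H W)
    {Y : SchemeOver ℂ} {D₁ : UnitaryBallUniformisationDatum 1 Y} {φ : Y ⟶ X} {M : Matrix (Fin 3) (Fin 2) ℂ}
    (h : D.IsCompatibleSpecialSource W D₁ φ M) (i : ℕ) :
    singularCohomology.map ℂ ℂ (AlgPoints.mapContinuous (L := ℂ) φ) i =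
      D.restrictToSpecial W i ≫
        singularCohomology.map ℂ ℂ
          (⟨fun y ↦ ⟨AlgPoints.map φ y, D.map_mem_specialPoints_of_isCompatibleSpecialSource hW h y⟩,
            (AlgPoints.continuous_map φ).subtype_mk _⟩ : C(ComplexPoints Y, D.specialPoints W)) i := by
  rw [restrictToSpecial_def, ← singularCohomology.map_comp, D.subtypeVal_comp_codRestrict_mapContinuous hW h]

/-- **A class dying on the image curve dies on every compatible source over it**: `restrictToSpecial W i c = 0 ⇒ Hⁱ(φ(ℂ)) c = 0`.
[cite: HatcherAT2002, §3.1] [cite: Liu2021, proof of Thm. 4.15, l. 2212] -/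
theorem map_mapContinuous_eq_zero_of_restrictToSpecial_eq_zero (D : UnitaryBallQuotientDatum 2 X)
    {W : Submodule D.E (Fin 3 → D.E)} (hW : IsTotallyPositive (conjRingHom D.E) D.H W)
    {Y : SchemeOver ℂ} {D₁ : UnitaryBallUniformisationDatum 1 Y} {φ : Y ⟶ X} {M : Matrix (Fin 3) (Fin 2) ℂ}
    (h : D.IsCompatibleSpecialSource W D₁ φ M) (i : ℕ) (c : complexBetti X i) (hc : D.restrictToSpecial W i c = 0) :
    singularCohomology.map ℂ ℂ (AlgPoints.mapContinuous (L := ℂ) φ) i c = 0 := by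
  rw [D.map_mapContinuous_eq_restrictToSpecial_comp hW h i, CategoryTheory.comp_apply, hc, map_zero]

/-- **III-8 `MR92Prop6` (image form) from III-8′ `MR92Prop6Source` (★ theorem) + «one compatible triple per line».**  If every totally
positive definite `E`-line `W ⊆ V` carries a compatible uniformised special curve `(Y, D₁, φ, M)` over `(D, W)`, then every non-zero
`c ∈ H¹(X(ℂ); ℂ)` restricts non-trivially to the special curve `C_W(ℂ)` of some totally positive definite line `W`: the source form gives
a line `W` on whose compatible sources `φ(ℂ)^* c ≠ 0`, and `φ(ℂ)^* c` factors through `restrictToSpecial W 1 c`.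
[cite: MurtyRamakrishnan1992, §5 Prop. 6 p. 460, Lemma B p. 462, Cor. C pp. 462–463] [cite: Liu2021, proof of Thm. 4.15, l. 2212 and footnote 9] -/
theorem mr92Prop6_of_forall_exists_compatibleSpecialSource (D : UnitaryBallQuotientDatum 2 X)
    (hex : ∀ W : Submodule D.E (Fin 3 → D.E), IsTotallyPositive (conjRingHom D.E) D.H W → Module.finrank D.E W = 1 →
      ∃ (Y : SchemeOver ℂ) (D₁ : UnitaryBallUniformisationDatum 1 Y) (φ : Y ⟶ X) (M : Matrix (Fin 3) (Fin 2) ℂ),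
        D.IsCompatibleSpecialSource W D₁ φ M) :
    MR92Prop6 D := by
  intro c hc
  obtain ⟨W, hW, h1, hall⟩ := D.toUnitaryBallUniformisationDatum.mr92Prop6Source c hc
  refine ⟨W, hW, h1, fun h0 ↦ ?_⟩
  obtain ⟨Y, D₁, φ, M, hsrc⟩ := hex W hW h1
  exact hall Y D₁ φ M hsrc (D.map_mapContinuous_eq_zero_of_restrictToSpecial_eq_zero hW hsrc 1 c h0)

/-- **Per-class form**: it suffices that the ONE detecting line handed by the source form for `c` carries a compatible source — the shape
a level-restricted existence theorem meets («for every totally positive line `W` there is a compatible special curve over `(D, W)`» may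
hold only after shrinking the level; the conclusion is asked class by class).  [cite: Liu2021, proof of Thm. 4.15, l. 2212 and footnote 9]
[cite: MurtyRamakrishnan1992, §5 Prop. 6 p. 460] -/
theorem restrictToSpecial_ne_zero_of_exists_compatibleSpecialSource (D : UnitaryBallQuotientDatum 2 X)
    (c : complexBetti X 1) (hc : c ≠ 0) :
    ∃ W : Submodule D.E (Fin 3 → D.E), IsTotallyPositive (conjRingHom D.E) D.H W ∧ Module.finrank D.E W = 1 ∧
      ((∃ (Y : SchemeOver ℂ) (D₁ : UnitaryBallUniformisationDatum 1 Y) (φ : Y ⟶ X) (M : Matrix (Fin 3) (Fin 2) ℂ),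
          D.IsCompatibleSpecialSource W D₁ φ M) → D.restrictToSpecial W 1 c ≠ 0) := by
  obtain ⟨W, hW, h1, hall⟩ := D.toUnitaryBallUniformisationDatum.mr92Prop6Source c hc
  refine ⟨W, hW, h1, ?_⟩
  rintro ⟨Y, D₁, φ, M, hsrc⟩ h0
  exact hall Y D₁ φ M hsrc (D.map_mapContinuous_eq_zero_of_restrictToSpecial_eq_zero hW hsrc 1 c h0)

end UnitaryBallQuotientDatum

end Literature.AlgebraicGeometry.ShimuraVarieties

end
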